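import Summits.RiemannHypothesis.RiemannHypothesis.Theorems.RuelleBandCofiniteCriticalLineStubCofiniteWeilCriterion
import HarnessLib

/-!
# Route `RuelleBand`, crux `CofiniteCriticalLine`, line `cofinite-weil-index-staircase` —
the stub `stub_polarZeroForm` (Stub C1, THE POLAR ZERO FORM)

Registered helper stub of the skeleton of the line `cofinite-weil-index-staircase` for the crux
`Summit.RiemannHypothesis.RiemannHypothesis.Theses.RuelleBand.CofiniteCriticalLine`
(item stmt-RiemannHypothesis-2064), proved BY NAME with the registered signature: for test
functions `g, h` (`IsWeilTest` = smooth + compact support) the Weil number `W(g ⋆ h̃)`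
(`weilFunctional (weilConv g (weilReflect h))`, `h̃(t) = conj h(-t)`) is the ABSOLUTELY CONVERGENT
zero sum `∑_ρ m(ρ) ĝ(ρ) conj ĥ(1 - ρ̄)` over the non-trivial zeros `ρ` of `ζ` (subtype
`ZetaZeros.riemannZetaNontrivialZeros`, multiplicity `m = riemannZetaZeroOrder`, `ĝ = weilMellin g`).
This is the polarised form of the diagonal identity `WeilConverse.zeroForm g = weilQuadratic g`
(`stub_cofiniteWeilCriterion_zeroForm_eq`, `WeilConverse.hasWeilZeroSide_zeroForm`), and the proof
is the same, line by line, with two test functions: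

* `(g ⋆ h̃)^(s) = ĝ(s) · conj ĥ(1 - conj s)` (`weilMellin_weilConv_holds`,
  `weilMellin_weilReflect_holds`; cf. `weilMellin_weilQuadratic`);
* `‖ĝ(ρ) conj ĥ(1 - ρ̄)‖ ≤ C_g C_h / (1 + γ²)²` on the non-trivial zeros (`norm_weilMellin_le` at
  `ρ` and at `1 - ρ̄`, same ordinate, real parts in `[0, 1]`; cf. `WeilConverse.norm_pairCoeff_le`),
  so `∑ ‖m(ρ) ĝ(ρ) conj ĥ(1 - ρ̄)‖ < ∞` (`summable_norm_zeroSide_of_le`);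
* hence the symmetric partial zero sums of `g ⋆ h̃` converge to the `tsum`
  (`hasWeilZeroSide_tsum`), while by the PROVED explicit formula (`explicit_formula_holds` at the
  test function `g ⋆ h̃`) they converge to `W(g ⋆ h̃)`; limits in `ℂ` are unique.

References: E. Bombieri, *Remarks on Weil's quadratic functional in the theory of prime numbers
I*, Rend. Lincei (9) 11 (2000), 183–233, §2 Thm. 2 and §3; A. Weil (1952).
-/

set_option linter.dupNamespace false

noncomputable section

open Complex MeasureTheory Filter Set
open scoped BigOperators Topology ComplexConjugate

namespace Summit.RiemannHypothesis.RiemannHypothesis.Theorems.RuelleBandCofiniteCriticalLine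

open Literature.NumberTheory.LFunctions

/-- **Transform of `g ⋆ h̃`**: `(g ⋆ h̃)^(s) = ĝ(s) · conj ĥ(1 - conj s)` for test functions `g, h`
(`weilMellin_weilConv_holds` and `weilMellin_weilReflect_holds`; the case `g = h` is
`weilMellin_weilQuadratic`). [cite: Bombieri2000Weil, §3] -/
theorem stub_polarZeroForm_weilMellin {g h : ℝ → ℂ} (hg : IsWeilTest g) (hh : IsWeilTest h)
    (s : ℂ) :
    weilMellin (weilConv g (weilReflect h)) s =
      weilMellin g s * conj (weilMellin h (1 - conj s)) := by
  -- adapted from `weilMellin_weilQuadratic` (Literature/NumberTheory/LFunctions/WeilExplicitProofs)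
  rw [weilMellin_weilConv_holds hg.1.continuous hg.2 hh.weilReflect.1.continuous hh.weilReflect.2,
    weilMellin_weilReflect_holds]

/-- **Decay of the polar coefficient on the zeros**: `‖ĝ(ρ) conj ĥ(1 - ρ̄)‖ ≤ C_g C_h / (1 + γ²)²`
for every non-trivial zero `ρ = β + iγ` (`norm_weilMellin_le` at `ρ` and at `1 - ρ̄`, which have
the same ordinate and real parts in `[0, 1]`; the case `g = h` is `WeilConverse.norm_pairCoeff_le`).
[folklore] -/
theorem stub_polarZeroForm_norm_le {g h : ℝ → ℂ} (hg : IsWeilTest g) (hh : IsWeilTest h)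
    {ρ : ℂ} (hρ : ρ ∈ ZetaZeros.riemannZetaNontrivialZeros) :
    ‖weilMellin g ρ * conj (weilMellin h (1 - conj ρ))‖ ≤
      weilDecayConst g * weilDecayConst h / (1 + ρ.im ^ 2) ^ 2 := by
  -- adapted from `WeilConverse.norm_pairCoeff_le` (Literature/…/WeilCriterionConverse.lean)
  have h1 : ‖weilMellin g ρ‖ ≤ weilDecayConst g / (1 + ρ.im ^ 2) :=
    norm_weilMellin_le hg (ZetaZeros.riemannZetaNontrivialZeros.re_pos hρ).le
      (ZetaZeros.riemannZetaNontrivialZeros.re_lt_one hρ).le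
  have h2 : ‖weilMellin h (1 - conj ρ)‖ ≤ weilDecayConst h / (1 + ρ.im ^ 2) := by
    have h2' := norm_weilMellin_le hh (s := 1 - conj ρ)
      (by rw [WeilConverse.one_sub_conj_re]
          linarith [ZetaZeros.riemannZetaNontrivialZeros.re_lt_one hρ])
      (by rw [WeilConverse.one_sub_conj_re]
          linarith [ZetaZeros.riemannZetaNontrivialZeros.re_pos hρ])
    rwa [WeilConverse.one_sub_conj_im] at h2'
  have h0 : 0 ≤ weilDecayConst g / (1 + ρ.im ^ 2) :=
    div_nonneg (weilDecayConst_nonneg g) (by positivity)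
  calc ‖weilMellin g ρ * conj (weilMellin h (1 - conj ρ))‖
      = ‖weilMellin g ρ‖ * ‖weilMellin h (1 - conj ρ)‖ := by rw [norm_mul, Complex.norm_conj]
    _ ≤ (weilDecayConst g / (1 + ρ.im ^ 2)) * (weilDecayConst h / (1 + ρ.im ^ 2)) :=
        mul_le_mul h1 h2 (norm_nonneg _) h0
    _ = weilDecayConst g * weilDecayConst h / (1 + ρ.im ^ 2) ^ 2 := by
        rw [div_mul_div_comm, ← pow_two]

/-- **Absolute convergence of the polar zero sum**: `∑_ρ ‖m(ρ) ĝ(ρ) conj ĥ(1 - ρ̄)‖ < ∞` for test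
functions `g, h` (`summable_norm_zeroSide_of_le` with the bound `stub_polarZeroForm_norm_le`; the
case `g = h` is `WeilConverse.summable_norm_pairCoeff`). [folklore] -/
theorem stub_polarZeroForm_summable {g h : ℝ → ℂ} (hg : IsWeilTest g) (hh : IsWeilTest h) :
    Summable fun ρ : ZetaZeros.riemannZetaNontrivialZeros =>
      ‖(riemannZetaZeroOrder (ρ : ℂ) : ℂ) *
        (weilMellin g ρ * conj (weilMellin h (1 - conj (ρ : ℂ))))‖ :=
  summable_norm_zeroSide_of_le (a := fun ρ ↦ weilMellin g ρ * conj (weilMellin h (1 - conj ρ)))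
    fun _ hρ ↦ stub_polarZeroForm_norm_le hg hh hρ

/-- **The polar zero sum is the zero side of `g ⋆ h̃`**:
`HasWeilZeroSide (g ⋆ h̃) (∑_ρ m(ρ) ĝ(ρ) conj ĥ(1 - ρ̄))` (`stub_polarZeroForm_weilMellin` termwise,
absolute convergence, `hasWeilZeroSide_tsum`; the case `g = h` is
`WeilConverse.hasWeilZeroSide_zeroForm`). [cite: Bombieri2000Weil, §3] -/
theorem stub_polarZeroForm_hasWeilZeroSide {g h : ℝ → ℂ} (hg : IsWeilTest g)
    (hh : IsWeilTest h) :
    HasWeilZeroSide (weilConv g (weilReflect h))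
      (∑' ρ : ZetaZeros.riemannZetaNontrivialZeros,
        (riemannZetaZeroOrder (ρ : ℂ) : ℂ) *
          (weilMellin g ρ * conj (weilMellin h (1 - conj (ρ : ℂ))))) := by
  -- adapted from `WeilConverse.hasWeilZeroSide_zeroForm` (Literature/…/WeilCriterionConverse.lean)
  have e : (fun ρ : ZetaZeros.riemannZetaNontrivialZeros ↦
      (riemannZetaZeroOrder (ρ : ℂ) : ℂ) * weilMellin (weilConv g (weilReflect h)) ρ) =
      fun ρ : ZetaZeros.riemannZetaNontrivialZeros ↦ (riemannZetaZeroOrder (ρ : ℂ) : ℂ) *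
        (weilMellin g ρ * conj (weilMellin h (1 - conj (ρ : ℂ)))) := by
    funext ρ
    rw [stub_polarZeroForm_weilMellin hg hh]
  have e' : (fun ρ : ZetaZeros.riemannZetaNontrivialZeros ↦
      ‖(riemannZetaZeroOrder (ρ : ℂ) : ℂ) * weilMellin (weilConv g (weilReflect h)) ρ‖) =
      fun ρ : ZetaZeros.riemannZetaNontrivialZeros ↦ ‖(riemannZetaZeroOrder (ρ : ℂ) : ℂ) *
        (weilMellin g ρ * conj (weilMellin h (1 - conj (ρ : ℂ))))‖ := by
    funext ρ
    rw [stub_polarZeroForm_weilMellin hg hh]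
  have hZ := hasWeilZeroSide_tsum (g := weilConv g (weilReflect h))
    (by rw [e']; exact stub_polarZeroForm_summable hg hh)
  rwa [e] at hZ

/-- **Stub `stub_polarZeroForm` — THE POLAR ZERO FORM (Stub C1 of the calibration `crux ⟹ END`).**
For test functions `g, h` the Weil number `W(g ⋆ h̃)` is the absolutely convergent zero sum
`∑_ρ m(ρ) ĝ(ρ) conj ĥ(1 - ρ̄)` over the non-trivial zeros: the symmetric partial zero sums of the
test function `g ⋆ h̃` converge both to `W(g ⋆ h̃)` (the PROVED explicit formula
`explicit_formula_holds`) and to the `tsum` (`stub_polarZeroForm_hasWeilZeroSide`: transform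
`ĝ(s) conj ĥ(1 - s̄)` by `weilMellin_weilConv_holds` / `weilMellin_weilReflect_holds`, absolute
convergence by `norm_weilMellin_le` and `summable_norm_zeroSide_of_le`, `hasWeilZeroSide_tsum`),
and limits are unique. The case `g = h` is `stub_cofiniteWeilCriterion_zeroForm_eq`.
[cite: Bombieri2000Weil, §2 Thm. 2 and §3] -/
theorem stub_polarZeroForm : ∀ {g h : ℝ → ℂ}, IsWeilTest g → IsWeilTest h →
    (Summable fun ρ : ZetaZeros.riemannZetaNontrivialZeros =>
      ‖(riemannZetaZeroOrder (ρ : ℂ) : ℂ) *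
        (weilMellin g ρ * conj (weilMellin h (1 - conj (ρ : ℂ))))‖) ∧
    weilFunctional (weilConv g (weilReflect h)) =
      ∑' ρ : ZetaZeros.riemannZetaNontrivialZeros,
        (riemannZetaZeroOrder (ρ : ℂ) : ℂ) *
          (weilMellin g ρ * conj (weilMellin h (1 - conj (ρ : ℂ)))) := by
  intro g h hg hh
  exact ⟨stub_polarZeroForm_summable hg hh,
    tendsto_nhds_unique (explicit_formula_holds (hg.weilConv hh.weilReflect))
      (stub_polarZeroForm_hasWeilZeroSide hg hh)⟩

/-- Curried corollary, equation alone: `W(g ⋆ h̃) = ∑_ρ m(ρ) ĝ(ρ) conj ĥ(1 - ρ̄)` for test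
functions `g, h`. [cite: Bombieri2000Weil, §2 Thm. 2 and §3] -/
theorem stub_polarZeroForm_eq {g h : ℝ → ℂ} (hg : IsWeilTest g) (hh : IsWeilTest h) :
    weilFunctional (weilConv g (weilReflect h)) =
      ∑' ρ : ZetaZeros.riemannZetaNontrivialZeros,
        (riemannZetaZeroOrder (ρ : ℂ) : ℂ) *
          (weilMellin g ρ * conj (weilMellin h (1 - conj (ρ : ℂ)))) :=
  (stub_polarZeroForm hg hh).2

end Summit.RiemannHypothesis.RiemannHypothesis.Theorems.RuelleBandCofiniteCriticalLine

end
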